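import Summits.BirchSwinnertonDyer.BirchSwinnertonDyer.Theorems.DefiniteThetaDerivedHeightCapTowerSqrtAnyPrimeAcLayerCyclic
import Summits.BirchSwinnertonDyer.BirchSwinnertonDyer.Theorems.DefiniteThetaDerivedHeightCapTowerSqrtGenerators
import HarnessLib

/-!
# Coherent generators of the anticyclotomic layer groups and their (unbounded) orders — for EVERY prime `p`

Route-independent `Theorems` file (cell `b2b-bsdres`, seat `b2b-bsdres-x10b`, gen 45), part 14 of the series «tower square root»
serving crux `DerivedHeightCap` (stmt-BirchSwinnertonDyer-18438, route DefiniteTheta), registered stub `stub_towerSqrt`.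
HONEST FRAMING: no curve asserted, no class closed, BSD not proved by any of this.

`K` imaginary quadratic, `p` ANY prime, `G̃_m = Pic(𝒪_{p^m})`, `Δ_m = torsionImage K p m`, `Q_m = G̃_m/Δ_m`. Part 7 transferred a
generator of `Q_2` up the tower; at `p = 2` the layer `Q_2` can be trivial and the cyclic structure of parts 11–13 starts at the
base level `2`, so here the transfer starts from `Q_3` (non-trivial for every prime, part 13 §2) and the levels `1, 2` are reached by
restriction DOWN the onto maps `G̃_3 → G̃_2 → G̃_1`:

* §1 `generates_mod_torsionImage_of_picRes_eq_three` (generator transfer from level `3`), **`exists_coherent_generators_mod_torsionImage_anyPrime`**: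
  classes `d_n ∈ G̃_{n+1}` with `res d_{n+1} = d_n`, each generating `G̃_{n+1}` modulo `Δ_{n+1}` — every prime `p`.
* §2 **`exists_natCard_acLayerGroup_eq_anyPrime`**: `#Q_{n+1} = p^{e_n}` with `n ≤ e_n + 1` (unbounded) — every prime `p`.

## References
* [BertoliniDarmon2005] §1.2 (18)–(21); [DarmonIovita2008] §2.2; [Washington1997] §13.2.
-/

noncomputable section

open scoped BigOperators

-- D-0017: single-problem summit, the namespace repeats the problem name by design.
set_option linter.dupNamespace false

namespace Summit.BirchSwinnertonDyer.BirchSwinnertonDyer.Theorems.TowerSqrt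

open Literature.NumberTheory.EllipticCurves Literature.NumberTheory.EllipticCurves.QuadOrderTower NumberField
open Summit.BirchSwinnertonDyer.BirchSwinnertonDyer.Theorems.DefmuSupersingularTheta
  (picRes_mem_torsionImage picRes_surjective_tower)

universe u

variable {K : Type u} [Field K] [NumberField K] (p : ℕ) [hp : Fact p.Prime]

/-! ### §1 Coherent generators, every prime -/

/-- **Generator transfer up the tower from level `3`** (`K` imaginary quadratic, every prime `p`): if `c₃` generates `G̃_3` modulo `Δ_3`
and `d ∈ G̃_{n+3}` restricts to `c₃`, then `d` generates `G̃_{n+3}` modulo `Δ_{n+3}` (in the cyclic `p`-group `Q_{n+3}` an element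
mapping to a generator of the non-trivial quotient `Q_3` is a generator, part 4 §2). [cite: BertoliniDarmon2005, §1.2 (18)–(21)] -/
theorem generates_mod_torsionImage_of_picRes_eq_three (hK : IsImaginaryQuadratic K) (n : ℕ)
    (c₃ : ClassGroup (quadOrder K (p ^ 3)))
    (hc₃ : ∀ x : ClassGroup (quadOrder K (p ^ 3)), ∃ i : ℕ, x * (c₃ ^ i)⁻¹ ∈ torsionImage K p 3)
    (d : ClassGroup (quadOrder K (p ^ (n + 3)))) (hd : picRes K (pow_dvd_pow p (by omega : 3 ≤ n + 3)) d = c₃) :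
    ∀ x : ClassGroup (quadOrder K (p ^ (n + 3))), ∃ i : ℕ, x * (d ^ i)⁻¹ ∈ torsionImage K p (n + 3) := by
  classical
  -- local instances: keep the typeclass search for the quotients away from `IsCyclic.isMulCommutative`
  haveI : ∀ m : ℕ, IsMulCommutative (ClassGroup (quadOrder K (p ^ m))) := fun m => CommMagma.to_isCommutative
  haveI : ∀ m : ℕ, Finite (ClassGroup (quadOrder K (p ^ m))) := fun m => finite_classGroup (K := K) _
  set N := torsionImage K p (n + 3) with hN
  set N₃ := torsionImage K p 3 with hN₃
  -- Q_{n+3} is a cyclic p-group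
  obtain ⟨c, hc⟩ := exists_generator_mod_torsionImage_of_ne_two_or p hK (n + 2) (Or.inr (by omega))
  have hcyc : IsCyclic (ClassGroup (quadOrder K (p ^ (n + 3))) ⧸ N) := by
    refine isCyclic_of_forall_exists_pow_eq (QuotientGroup.mk' N c) fun q => ?_
    obtain ⟨x, rfl⟩ := QuotientGroup.mk'_surjective N q
    obtain ⟨i, hi⟩ := hc x
    refine ⟨i, ?_⟩
    rw [← map_pow, QuotientGroup.mk'_apply, QuotientGroup.mk'_apply, QuotientGroup.eq]
    have : (c ^ i)⁻¹ * x = x * (c ^ i)⁻¹ := mul_comm _ _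
    rw [this]; exact hi
  have hP : IsPGroup p (ClassGroup (quadOrder K (p ^ (n + 3))) ⧸ N) := isPGroup_acLayerGroup p hK (n + 2)
  have hP₃ : IsPGroup p (ClassGroup (quadOrder K (p ^ 3)) ⧸ N₃) := isPGroup_acLayerGroup p hK 2
  -- Q_3 is non-trivial
  obtain ⟨h, -, hh⟩ := exists_pow_prime_pow_not_mem_three p hK 0
  have hy : QuotientGroup.mk' N₃ (h ^ p ^ 0) ≠ 1 := by
    rw [QuotientGroup.mk'_apply]
    exact fun h1 => hh ((QuotientGroup.eq_one_iff _).mp h1)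
  -- the map Q_{n+3} → Q_3
  have hle : N ≤ N₃.comap (picRes K (pow_dvd_pow p (by omega : 3 ≤ n + 3))) := fun t ht =>
    Subgroup.mem_comap.mpr (picRes_mem_torsionImage p (by omega) ht)
  set f := QuotientGroup.map N N₃ (picRes K (pow_dvd_pow p (by omega : 3 ≤ n + 3))) hle with hf
  -- the image of [d] generates Q_3
  have hfd : ∀ y : ClassGroup (quadOrder K (p ^ 3)) ⧸ N₃, ∃ k : ℕ, (f (QuotientGroup.mk' N d)) ^ k = y := by
    intro y
    obtain ⟨x, rfl⟩ := QuotientGroup.mk'_surjective N₃ y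
    obtain ⟨i, hi⟩ := hc₃ x
    refine ⟨i, ?_⟩
    rw [hf, QuotientGroup.mk'_apply, QuotientGroup.map_mk, hd, ← QuotientGroup.mk_pow, QuotientGroup.mk'_apply, QuotientGroup.eq]
    have : (c₃ ^ i)⁻¹ * x = x * (c₃ ^ i)⁻¹ := mul_comm _ _
    rw [this]; exact hi
  have hgen := forall_exists_pow_eq_of_map hP hcyc hP₃ hy f (QuotientGroup.mk' N d) hfd
  intro x
  obtain ⟨i, hi⟩ := hgen (QuotientGroup.mk' N x)
  refine ⟨i, ?_⟩
  rw [← map_pow, QuotientGroup.mk'_apply, QuotientGroup.mk'_apply, QuotientGroup.eq] at hi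
  have : (d ^ i)⁻¹ * x = x * (d ^ i)⁻¹ := mul_comm _ _
  rw [← this]; exact hi

/-- **Coherent generators of the layers, every prime `p`**: classes `d_n ∈ Pic(𝒪_{p^{n+1}})` with `res d_{n+1} = d_n`, each generating
`Pic(𝒪_{p^{n+1}})` modulo `Δ` — the images of one topological generator of `G_∞ = G̃_∞/Δ ≅ ℤ_p` (a generator of `Q_3` lifted coherently
up the tower and restricted down to `Q_2`, `Q_1`). [cite: BertoliniDarmon2005, §1.2 (18)–(21)] [cite: Washington1997, §13.2] -/
theorem exists_coherent_generators_mod_torsionImage_anyPrime (hK : IsImaginaryQuadratic K) :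
    ∃ d : ∀ n : ℕ, ClassGroup (quadOrder K (p ^ (n + 1))),
      (∀ n, picRes K (pow_dvd_pow p (n + 1).le_succ) (d (n + 1)) = d n) ∧
      ∀ n (x : ClassGroup (quadOrder K (p ^ (n + 1)))), ∃ i : ℕ, x * (d n ^ i)⁻¹ ∈ torsionImage K p (n + 1) := by
  classical
  obtain ⟨c₃, hc₃⟩ := exists_generator_mod_torsionImage_of_ne_two_or p hK 2 (Or.inr (by omega))
  -- lift c₃ coherently: e n ∈ G̃_{n+3}
  have hsurj : ∀ (n : ℕ) (x : ClassGroup (quadOrder K (p ^ (n + 3)))),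
      ∃ y : ClassGroup (quadOrder K (p ^ (n + 4))), picRes K (pow_dvd_pow p (n + 3).le_succ) y = x :=
    fun n x => picRes_surjective_tower p hK 1 (n + 2) (n + 4) (by omega) x
  let e : ∀ n : ℕ, ClassGroup (quadOrder K (p ^ (n + 3))) := fun n =>
    Nat.rec (motive := fun n => ClassGroup (quadOrder K (p ^ (n + 3)))) c₃ (fun n en => Classical.choose (hsurj n en)) n
  have he0 : e 0 = c₃ := rfl
  have hesucc : ∀ n, picRes K (pow_dvd_pow p (n + 3).le_succ) (e (n + 1)) = e n := fun n =>
    Classical.choose_spec (hsurj n (e n))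
  have heres : ∀ n, picRes K (pow_dvd_pow p (by omega : 3 ≤ n + 3)) (e n) = c₃ := by
    intro n
    induction n with
    | zero => exact (picRes_self _ _).trans he0
    | succ n ih =>
      rw [← picRes_picRes (pow_dvd_pow p (by omega : 3 ≤ n + 3)) (pow_dvd_pow p (n + 3).le_succ), hesucc]; exact ih
  -- the family d: levels 1, 2 are restrictions of c₃, level n+3 is e n
  let d : ∀ n : ℕ, ClassGroup (quadOrder K (p ^ (n + 1))) := fun n =>
    match n with
    | 0 => picRes K (pow_dvd_pow p (by omega : 1 ≤ 3)) c₃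
    | 1 => picRes K (pow_dvd_pow p (by omega : 2 ≤ 3)) c₃
    | n + 2 => e n
  refine ⟨d, fun n => ?_, fun n => ?_⟩
  · match n with
    | 0 =>
      show picRes K _ (picRes K _ c₃) = picRes K _ c₃
      rw [picRes_picRes]
    | 1 => show picRes K _ (e 0) = picRes K _ c₃; rw [he0]
    | n + 2 => exact hesucc n
  · match n with
    | 0 =>
      exact generates_mod_torsionImage_picRes p (by omega : 1 ≤ 3) c₃ hc₃
        (picRes_surjective_tower p hK 2 0 3 (by omega))
    | 1 =>
      exact generates_mod_torsionImage_picRes p (by omega : 2 ≤ 3) c₃ hc₃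
        (picRes_surjective_tower p hK 1 1 3 (by omega))
    | n + 2 => exact generates_mod_torsionImage_of_picRes_eq_three p hK n c₃ hc₃ (e n) (heres n)

/-! ### §2 The orders `#Q_{n+1} = p^{e_n}` are unbounded, every prime -/

/-- **`#(Pic(𝒪_{p^{n+1}})/Δ) = p^{e_n}` with `n ≤ e_n + 1`**, every prime `p`: the layer group is a `p`-group (part 5 §4) and `Q_{k+3}`
contains a class of order `p^{k+1}` (part 13 §2). [cite: BertoliniDarmon2005, §1.2 (18)–(21)] -/
theorem exists_natCard_acLayerGroup_eq_anyPrime (hK : IsImaginaryQuadratic K) (n : ℕ) :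
    ∃ e : ℕ, Nat.card (AcLayerGroup K p (n + 1)) = p ^ e ∧ n ≤ e + 1 := by
  classical
  haveI : ∀ m : ℕ, IsMulCommutative (ClassGroup (quadOrder K (p ^ m))) := fun m => CommMagma.to_isCommutative
  haveI : Finite (ClassGroup (quadOrder K (p ^ (n + 1)))) := finite_classGroup (K := K) _
  obtain ⟨e, he⟩ := (IsPGroup.iff_card).mp (isPGroup_acLayerGroup p hK n)
  refine ⟨e, he, ?_⟩
  match n with
  | 0 => exact Nat.zero_le _
  | 1 => omega
  | k + 2 =>
    -- an element of order p^{k+1} in Q_{k+3}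
    obtain ⟨h, hh1, hh2⟩ := exists_pow_prime_pow_not_mem_three p hK k
    set q := QuotientGroup.mk' (torsionImage K p (k + 3)) h with hq
    have hord : orderOf q = p ^ (k + 1) := by
      refine orderOf_eq_prime_pow ?_ ?_
      · rw [hq, ← map_pow, QuotientGroup.mk'_apply]
        exact fun h1 => hh2 ((QuotientGroup.eq_one_iff _).mp h1)
      · rw [hq, ← map_pow, hh1, map_one]
    have hdvd : p ^ (k + 1) ∣ Nat.card (AcLayerGroup K p (k + 2 + 1)) := by
      rw [← hord]; exact orderOf_dvd_natCard q
    rw [he] at hdvd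
    have := (Nat.pow_dvd_pow_iff_le_right hp.out.one_lt).mp hdvd
    omega

end Summit.BirchSwinnertonDyer.BirchSwinnertonDyer.Theorems.TowerSqrt

end
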